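import Summits.Ventures.CertifiedManyBodySolver.Theorems.M3x2EdgeSplitSymReplayOutRouteMF
import HarnessLib

/-!
# SymReplay checker — packed module facts WITHOUT the run-time box test («P0»): the box membership of every share is a THEOREM

(team lb-sym, cell hub-lb; hub-lb-sym-eng-4 g2.  ADDITIVE on `…PackedHB` / `…OutRouteHS` / `…OutRouteMF`; nothing landed is
touched.)

WHY.  The packed per-module Boolean of record `PackedNF.ppipeOKHBZ lo hi oP s = psuppInB lo hi s && pisZero (…)` re-tests at
run time that every letter of the share lies in the box — measured ≈ 7 µs per product (5.1 s of a 55-s module on rung V,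
≈ 8.5 % of the packed pipe).  But it is PROVABLE once and for all: every share `S m` is a permutation of `shareR K κ J m`, whose
words are supported in `K.frame` (`PSupp_sharesR`, from `hwf` + `hRok`), and under the box licence every frame site is in the box.
So the fact a module evaluates can be the bare `pisZero (pcanonNFZHBZ lo hi oP (encP lo hi (S m))) = true`.

CONTENTS.  `PInB_of_PSupp` (box licence + frame support ⇒ `PackedNF.PInB`), `OutFactsP0 lo hi oP S i n` (bare packed facts),
`OutFactsP0.append`, `outFactsHSBZ_of_packed0` (needs `PInB` of the shares), the generic closing **`energyDensity_ge_of_outroutePS0`**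
(substituted skeleton `hS`, bare packed facts), and the instances of record **`energyDensity_ge_of_outroutePMF0`** (hierarchical
routing, `J·L` modules), `…PMKD0` (key iteration), `…PM0` (targets), `…P0` (spec shares).  MODULE GRAMMAR: per module
`out_m : PackedNF.pisZero (PackedNF.pcanonNFZHBZ lo hi PackedNF.oracleV3 (PackedNF.encP lo hi (shareRFastMF momSpecC cert gbs tabC
κ₂ J L (m / L) (m % L)))) = true := by native_decide`; close `energyDensity_ge_of_outroutePMF0 … hfacts`.  Standard axioms.

HONEST FRAMING: a checker COST lever by proof (one run-time test removed); no certificate lands by this file; no bound of record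
moves; no summit or crux statement is proved here; nothing here predicts superconductivity.
-/

namespace Summit.Ventures.CertifiedManyBodySolver.Theorems.SymReplay

open Literature.MathematicalPhysics.QuantumLattice
open Literature.MathematicalPhysics.QuantumLattice.HubbardWave0
open Literature.MathematicalPhysics.QuantumLattice.ThermodynamicLimit
open Literature.Probability.LatticeModels
open Literature.MathematicalPhysics.QuantumManyBody.StateRelaxation
open Summit.Ventures.CertifiedManyBodySolver.Theorems.WardSlot

/-- Under the box licence, a polynomial supported in the frame lies in the box (packed sense). -/
theorem PInB_of_PSupp {frame : List (Site 2)} {lo hi : ℤ × ℤ} (hb : boxLicence frame lo hi = true) {p : QPoly}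
    (hp : PSupp p frame.toFinset) : PackedNF.PInB lo hi p := by
  intro t ht ℓ hℓ
  have hx : ℓ.x ∈ frame := List.mem_toFinset.1 (hp t ht ℓ hℓ)
  unfold boxLicence at hb
  simp only [Bool.and_eq_true, List.all_eq_true] at hb
  exact hb.1.2 ℓ.x hx

/-- Bare packed per-module facts (no run-time box test): modules `i, …, i+n−1`. -/
def OutFactsP0 (lo hi : ℤ × ℤ) (oP : PackedNF.PWord → PackedNF.PHint) (S : ℕ → QPoly) : ℕ → ℕ → Prop
  | _, 0 => True
  | i, n + 1 => PackedNF.pisZero (PackedNF.pcanonNFZHBZ lo hi oP (PackedNF.encP lo hi (S i))) = true ∧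
      OutFactsP0 lo hi oP S (i + 1) n

/-- Concatenate two consecutive chunks of bare packed facts. -/
theorem OutFactsP0.append {lo hi : ℤ × ℤ} {oP : PackedNF.PWord → PackedNF.PHint} {S : ℕ → QPoly} :
    ∀ {m i n : ℕ}, OutFactsP0 lo hi oP S i m → OutFactsP0 lo hi oP S (i + m) n → OutFactsP0 lo hi oP S i (m + n)
  | 0, i, n, _, h2 => by simpa [Nat.zero_add] using h2
  | m + 1, i, n, h1, h2 => by
    rw [Nat.add_right_comm]
    exact ⟨h1.1, OutFactsP0.append h1.2 (by rw [Nat.add_assoc, Nat.add_comm 1 m]; exact h2)⟩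

/-- Bare packed facts + box membership of the shares give executed hinted facts for the induced oracle. -/
theorem outFactsHSBZ_of_packed0 (K : SymCertR) (lo hi : ℤ × ℤ) (oP : PackedNF.PWord → PackedNF.PHint) (S : ℕ → QPoly)
    (N : ℕ) (hB : ∀ k, k < N → PackedNF.PInB lo hi (S k)) :
    ∀ (n i : ℕ), i + n ≤ N → OutFactsP0 lo hi oP S i n → OutFactsHSBZ K (PackedNF.oracleOfP lo hi oP) S lo hi i n := by
  intro n
  induction n with
  | zero => intro i _ _; exact trivial
  | succ n ih =>
    intro i hle hf
    refine ⟨?_, ih (i + 1) (by omega) hf.2⟩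
    rw [← PackedNF.pisZero_pcanonNFZHBZ oP (hB i (by omega))]
    exact hf.1

/-- **Closing theorem, substituted skeleton, BARE packed facts** (box membership discharged by `hS` + `PSupp_sharesR` + licence). -/
theorem energyDensity_ge_of_outroutePS0 (K : SymCertR) (hwf : wellFormed K.expand = true)
    (hRok : K.gramR.all (gramBlockROK K.frame) = true) (oP : PackedNF.PWord → PackedNF.PHint) (κ : Word → ℕ) (J : ℕ)
    (hJ : 0 < J) (S : ℕ → QPoly) (hS : ∀ i, i < J → (S i).Perm (shareR K κ J i)) (lo hi : ℤ × ℤ)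
    (hbox : boxLicence K.frame lo hi = true) (hfacts : OutFactsP0 lo hi oP S 0 J) :
    ((symValueR K : ℚ) : ℝ) ≤ energyDensityTT' 1 0 8 (7 / 8) := by
  have hwfb : wellFormed K.toSymCert = true := wellFormed_toSymCert_of_expand K hwf
  have hB : ∀ k, k < J → PackedNF.PInB lo hi (S k) := fun k hk => by
    refine PInB_of_PSupp hbox fun t ht => ?_
    have hsh : PSupp (shareR K κ J k) K.frame.toFinset :=
      PSupp_sharesR K hwfb hRok κ J _ (by rw [sharesR, List.mem_map]; exact ⟨k, List.mem_range.2 hk, rfl⟩)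
    exact hsh t ((hS k hk).mem_iff.1 ht)
  exact energyDensity_ge_of_outrouteHSBZ K hwf hRok (PackedNF.oracleOfP lo hi oP) κ J hJ S hS lo hi hbox
    (outFactsHSBZ_of_packed0 K lo hi oP S J hB J 0 (by omega) hfacts)

section Instances

variable {Mo : Type} [DecidableEq Mo] [Hashable Mo]

/-- **Hierarchical routing, bare packed facts (`J·L` modules) — the E-class grammar of record after this file:**
`out_m : PackedNF.pisZero (PackedNF.pcanonNFZHBZ lo hi oP (PackedNF.encP lo hi (shareRFastMF Sm K (K.gramR.map genBasis) hm κ₂ J L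
(m / L) (m % L)))) = true := by native_decide`. -/
theorem energyDensity_ge_of_outroutePMF0 (Sm : MomSpec Mo) (K : SymCertR) (hwf : wellFormed K.expand = true)
    (hRok : K.gramR.all (gramBlockROK K.frame) = true) (oP : PackedNF.PWord → PackedNF.PHint) (hm : MomTable Mo)
    (κ₂ : Word → ℕ) (J L : ℕ) (hJ : 0 < J) (hL : 0 < L) (lo hi : ℤ × ℤ) (hbox : boxLicence K.frame lo hi = true)
    (hcov : coverM Sm K (K.gramR.map genBasis) hm = true)
    (hfacts : OutFactsP0 lo hi oP (fun m => shareRFastMF Sm K (K.gramR.map genBasis) hm κ₂ J L (m / L) (m % L)) 0 (J * L)) :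
    ((symValueR K : ℚ) : ℝ) ≤ energyDensityTT' 1 0 8 (7 / 8) :=
  energyDensity_ge_of_outroutePS0 K hwf hRok oP (momKey₂ Sm hm κ₂ J L) (J * L) (Nat.mul_pos hJ hL) _
    (fun m _ => shareRFastMF_perm_lin Sm K hm κ₂ hJ hL hcov m) lo hi hbox hfacts

/-- Key iteration with per-hit dots, bare packed facts (no coverage fact). -/
theorem energyDensity_ge_of_outroutePMKD0 (Sm : MomSpec Mo) (K : SymCertR) (hwf : wellFormed K.expand = true)
    (hRok : K.gramR.all (gramBlockROK K.frame) = true) (oP : PackedNF.PWord → PackedNF.PHint) (hm : MomTable Mo) (J : ℕ)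
    (hJ : 0 < J) (lo hi : ℤ × ℤ) (hbox : boxLicence K.frame lo hi = true)
    (hfacts : OutFactsP0 lo hi oP (fun i => shareRFastMKD Sm K (K.gramR.map genBasis) hm J i) 0 J) :
    ((symValueR K : ℚ) : ℝ) ≤ energyDensityTT' 1 0 8 (7 / 8) :=
  energyDensity_ge_of_outroutePS0 K hwf hRok oP (momKey Sm hm) J hJ _ (fun i _ => shareRFastMKD_perm Sm K hm J i) lo hi hbox
    hfacts

/-- Targets scheme (T20c's `shareRFastM`), bare packed facts. -/
theorem energyDensity_ge_of_outroutePM0 (Sm : MomSpec Mo) (K : SymCertR) (hwf : wellFormed K.expand = true)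
    (hRok : K.gramR.all (gramBlockROK K.frame) = true) (oP : PackedNF.PWord → PackedNF.PHint) (hm : MomTable Mo) (J : ℕ)
    (hJ : 0 < J) (lo hi : ℤ × ℤ) (hbox : boxLicence K.frame lo hi = true) (hcov : coverM Sm K (K.gramR.map genBasis) hm = true)
    (hfacts : OutFactsP0 lo hi oP (fun i => shareRFastM Sm K (K.gramR.map genBasis) hm J i) 0 J) :
    ((symValueR K : ℚ) : ℝ) ≤ energyDensityTT' 1 0 8 (7 / 8) :=
  energyDensity_ge_of_outroutePS0 K hwf hRok oP (momKey Sm hm) J hJ _ (fun i _ => shareRFastM_perm Sm K hm J i hcov)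
    lo hi hbox hfacts

end Instances

/-- Spec shares, bare packed facts (rung-V size): `out_i : PackedNF.pisZero (… (PackedNF.encP lo hi (shareR K κ J i))) = true`. -/
theorem energyDensity_ge_of_outrouteP0 (K : SymCertR) (hwf : wellFormed K.expand = true)
    (hRok : K.gramR.all (gramBlockROK K.frame) = true) (oP : PackedNF.PWord → PackedNF.PHint) (κ : Word → ℕ) (J : ℕ)
    (hJ : 0 < J) (lo hi : ℤ × ℤ) (hbox : boxLicence K.frame lo hi = true)
    (hfacts : OutFactsP0 lo hi oP (shareR K κ J) 0 J) : ((symValueR K : ℚ) : ℝ) ≤ energyDensityTT' 1 0 8 (7 / 8) :=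
  energyDensity_ge_of_outroutePS0 K hwf hRok oP κ J hJ _ (fun _ _ => List.Perm.refl _) lo hi hbox hfacts

end Summit.Ventures.CertifiedManyBodySolver.Theorems.SymReplay
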